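import Summits.QuantumFields.YangMills.Theorems.FemtoTransferGapSlabFlowLift
import Summits.Ventures.LatticeQCDFlow.Scoring.WilsonFlowReflectionCovariance
import Literature.MathematicalPhysics.QuantumFieldTheory.ConstructiveQFTWave0WilsonLoopRPProofs
import HarnessLib

/-!
# The Wilson flow and the Polyakov holonomy triple intertwine the reflection `Θ'` of the fine torus with the link inversion of the one-site model:
# `(f ∘ Π_t)(Θ'U) = ((f ∘ Θ'₁) ∘ Π_t)(U)` at base point `0`

Fleet-service module of seat ym-infvol-p1 g6 (route `LuscherReduction`, femto rung R2b1; bears on crux child `DressedRitz` = stmt-QuantumFields-20205,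
line «polyakovlift», stub S-STAT `stub_liftStatics`).  Companion of `…FemtoTransferGapSlabFlowLiftAxisPermutation.lean` (seat g5, axis permutations):
the reflection `Θ' = GaugeConfig.negReflect` of axis `0` of the spatial torus (the tree's site reflection) commutes with the Wilson flow
(`Summit.Ventures.LatticeQCDFlow.Scoring.wilsonFlow_negReflect`, by flow-line uniqueness), and the straight-line holonomies of the reflected field
through the base point `0` are those of the field, the one along axis `0` INVERTED (`WilsonLoopRP.lineHolonomy_negReflect_zero ∕ _of_ne`).  On the
one-point torus the reflection `Θ'₁ = GaugeConfig.negReflect` is exactly «invert the link along axis `0`», so the flowed Polyakov lift at base point `0`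
intertwines the two reflections.

HONEST FRAMING: fixed-lattice symmetry bookkeeping; no renormalisation-group content; nothing here bears on infinite volume, the continuum limit
or the Clay gap.  References: M. Lüscher, JHEP 08 (2010) 071, §2 [cite: Luscher2010, §2]; M. Lüscher, NPB 219 (1983) 233, §2 [cite: Luscher1983, §2].
-/

set_option autoImplicit false

noncomputable section

open MeasureTheory Filter Topology
open Literature.MathematicalPhysics.QuantumFieldTheory
open Literature.MathematicalPhysics.QuantumFieldTheory.WilsonSiteRP
open Literature.MathematicalPhysics.QuantumLattice
open scoped BigOperators

namespace Summit.QuantumFields.YangMills.Theorems.FemtoTransferGap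

/-! ## §1 Polyakov holonomies of the reflected field -/

section Polyakov

variable {G : Type*} [Group G] {L : ℕ}

/-- The base point `0` is fixed by the site reflection. [folklore] -/
theorem site_negReflect_zero : (0 : Site 3 L).negReflect = 0 :=
  negReflect_of_two_mul (by simp)

/-- **The Polyakov triple of the reflected field at the base point `0` is the reflected Polyakov triple**: as one-site configurations,
`polyakovSite 0 (Θ'U) = Θ'₁ (polyakovSite 0 U)`, where on the one-point torus `Θ'₁ = GaugeConfig.negReflect` inverts the link along axis `0` and keeps
the other two (`WilsonLoopRP.lineHolonomy_negReflect_zero`: the closed line along axis `0` through `0` is traversed backwards from the same base point,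
`L • e₀ = 0`; `…_of_ne`: the lines along the other axes through `0` are pointwise fixed). [cite: Luscher1983, §2] -/
theorem polyakovSite_zero_negReflect (U : GaugeConfig 3 L G) :
    polyakovSite 0 U.negReflect = (polyakovSite 0 U).negReflect := by
  funext e
  obtain ⟨x, μ⟩ := e
  by_cases hμ : μ = 0
  · subst hμ
    have hL : (0 : Site 3 L) + Pi.single 0 ((L : ℕ) : ZMod L) = 0 := by
      rw [ZMod.natCast_self, Pi.single_zero, add_zero]
    simp only [polyakovSite, GaugeConfig.negReflect, if_true]
    rw [WilsonLoopRP.lineHolonomy_negReflect_zero U L 0, hL, site_negReflect_zero]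
  · simp only [polyakovSite, GaugeConfig.negReflect, hμ, if_false]
    rw [WilsonLoopRP.lineHolonomy_negReflect_of_ne U hμ L 0, site_negReflect_zero]

/-- On the one-point torus the reflection is the involution «invert the link along axis `0`»: `(Θ'₁V)(x, 0) = V(x, 0)⁻¹`, `(Θ'₁V)(x, k) = V(x, k)` for
`k ≠ 0` (all sites of `(ℤ/1)³` coincide). [folklore] -/
theorem negReflect_one_site_apply (V : GaugeConfig 3 1 G) (x : Site 3 1) (μ : Fin 3) :
    V.negReflect (x, μ) = if μ = 0 then (V (x, μ))⁻¹ else V (x, μ) := by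
  have hx : ∀ y : Site 3 1, y = x := fun y => Subsingleton.elim y x
  by_cases hμ : μ = 0
  · subst hμ
    simp only [GaugeConfig.negReflect, if_true, hx ((x.shift 0).negReflect)]
  · simp only [GaugeConfig.negReflect, hμ, if_false, hx x.negReflect]

end Polyakov

/-! ## §2 ★ The flowed Polyakov lift intertwines the two reflections -/

section Lift

variable {L : ℕ} [NeZero L]

/-- **`(f∘Π_t)(Θ'U) = ((f ∘ Θ'₁)∘Π_t)(U)`** at base point `0`: the flowed Polyakov lift of `f` evaluated on the reflected fine field is the flowed
Polyakov lift of the reflected one-site function `f ∘ Θ'₁` (the flow commutes with `Θ'`: `LatticeQCDFlow.Scoring.wilsonFlow_negReflect`).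
[cite: Luscher2010, §2] [cite: Luscher1983, §2] -/
theorem flowLiftAt_zero_negReflect (t : ℝ) (f : GaugeConfig 3 1 SU2 → ℝ) (U : GaugeConfig 3 L SU2) :
    flowLiftAt 0 t f U.negReflect = flowLiftAt 0 t (fun V => f V.negReflect) U := by
  simp only [flowLiftAt, Summit.Ventures.LatticeQCDFlow.Scoring.wilsonFlow_negReflect, polyakovSite_zero_negReflect]

/-- Function form: `flowLiftAt 0 t f ∘ Θ' = flowLiftAt 0 t (f ∘ Θ'₁)`. [cite: Luscher2010, §2] -/
theorem flowLiftAt_zero_comp_negReflect (t : ℝ) (f : GaugeConfig 3 1 SU2 → ℝ) :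
    (fun U : GaugeConfig 3 L SU2 => flowLiftAt 0 t f U.negReflect) = flowLiftAt 0 t (fun V => f V.negReflect) :=
  funext fun U => flowLiftAt_zero_negReflect t f U

end Lift

end Summit.QuantumFields.YangMills.Theorems.FemtoTransferGap

end
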